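import Summits.QuantumFields.YangMills.Theorems.BalabanUVNodesSpineReadingOfRecord13CoPHKComponentSizeBlocksFreshTowerFibre

/-!
# THE N20 FACE AT THE LIVE-PINNED CoPH RECORD FROM PER-HISTORY ONE-STEP LETTERS ALONE (companion of `…BlocksFreshTowerFibre`: its run-A ∕ run-B derivations of the
# class-level one-step fresh letters plugged into `…BlocksFreshTowerT`'s face, (T) being a theorem there)

Cell `pub-ymgap`, YM-PLAN Track A (HUMAN RULING D-0062; width push D-0149); seat `pub-ymgap-dag-n20-d` (R134 (a) N20 NE7b s3 = the U5d ∕ `crOfRecord₁₃` lineage, its declarer)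
gen 37.  `--kind proof --supports stmt-QuantumFields-27366 --as helper` (K3⁸); COUNT-NEUTRAL; THEOREMS ONLY (0 `def`).  [III] = [Balaban1988Convergent]; [LF-II] = [Balaban1989LargeFieldII].

WHAT.  ★★★★ `relWeightBound_card_of_fibreFreshLetters_id_supNear_of_ppSelLive`: `…BlocksFreshTowerT.relWeightBound_card_of_oneStepFreshLetters_id_supNear_of_ppSelLive` with its
class-level one-step letters hOA ∕ hOB replaced by PER-HISTORY (conditional) one-step letters hFA ∕ hFB — for every step `K`, source `|t| ≤ 1`, level `j ∈ [1, jcut K]`, member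
`(y₀, B)` of the separated cover family, assignment `a : b ↦ (i_b, c_b)`, and every HISTORY `π₀` (run A: a level-`m` sequence, `m + 1 ≤ j`; run B: a length-`n` sequence, `n ∈ [1, j]`,
read one level up) in which the cubes of the next level are still small: the (2.18)-mass of the one-step extensions of `π₀` in which those cubes all turn large is at most
`(Π_{those b} ζ K j i_b)` times the mass of `π₀`.  GIVEN the numerics, `jcut K ≤ K₀ + K`, the live pin, (H-U) and `0 ≤ θ.ζ` (which make (T) a theorem and the class weights
non-negative).  This is the shape of [LF-II]'s fundamental inequality (1.89) p. 387 (`T_k(X) 1 ≤ exp(−2(1+β₀)⁻¹ p₀(g_k))`, conditional on the whole past) read on the (2.18)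
class weights — the ONE remaining letter of N20's size reading at the live pin.

HONEST FRAMING.  [bookkeeping] composition BY NAME; hFA ∕ hFB are HYPOTHESES inhabited for no family today — (1.89)'s KIND, whose printed proof uses Theorem 1 [III]'s inductive
representation (2.21) of the effective densities; NOT PRINTED as a statement about the (2.18) class weights; NO weight is bounded, NO estimate proved; nothing of Bałaban's
asserted; NE7 ∕ NE7b ∕ NE7c NOT PRINTED for `d = 4` ∕ NOT proved; no `Provisos₁₃CoPH` inhabitant claimed (K0⁷ OPEN); K3⁸ v7 untouched; N19 ∕ N20 ∕ N21 ∕ N27 NOT discharged;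
counts UNMOVED (typed 28∕28 · discharged 8∕27); one finite four-torus programme at fixed `ε` — NOT ℝ⁴, NOT OS, NOT a mass gap, NOT the Clay problem.  No `def`, no
`instance`, no `notation`, no `sorry`; no decl below carries a cite tag.
-/

noncomputable section

open MeasureTheory
open scoped BigOperators
open Finset

namespace YMDAG.UVSplit

open Literature.MathematicalPhysics.QuantumFieldTheory.Balaban1983to89
open Literature.MathematicalPhysics.QuantumFieldTheory.Balaban1983to89.T4Continuum
open Literature.MathematicalPhysics.QuantumFieldTheory.Balaban1983to89.Node00
open Literature.MathematicalPhysics.QuantumFieldTheory.Balaban1983to89.B14.Eq218Concrete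
open Literature.MathematicalPhysics.QuantumFieldTheory.Balaban1983to89.B5Eq118OneStroke (iterBlockOf iterBlock)
open Summit.QuantumFields.YangMills.BalabanUVNodes.N19MGFRoadLiveSelectorTower (dressedSlotsOfDatum₉_nonneg)
open T4WeightBudget (RelWeightBound)

section Faces

variable {F : T4Family} {N : ℕ} [NeZero N]
variable (θ : Stage13HParams F N) (hP : θ.Provisos₁₃CoPH F N) (K₀ : ℕ) (g₀ : ℕ → ℝ) (os : List (ULoop F)) (jcut : ℕ → ℕ) (ϱ k lv : ℕ → ℕ → ℕ)

open scoped Classical in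
/-- ★★★★ **THE N20 FACE AT THE RECORD's CARRIERS FROM PER-HISTORY ONE-STEP LETTERS ALONE, AT THE LIVE-PINNED CoPH RECORD.**  Same numerics as the sibling faces and
`jcut K ≤ K₀ + K`; GIVEN the live pin, (H-U) and `0 ≤ θ.ζ`; per run ONE letter family, CONDITIONAL ON THE HISTORY — hFA: for every `K`, `|t| ≤ 1`, `j ∈ [1, jcut K]`, member `p`
of the separated cover family, assignment `a`, every `m` with `m + 1 ≤ j` and every level-`m` run-A sequence `π₀` with `c_b ⊆ Λ_{i_b − 1}(π₀)` for the cubes of level `i_b = m + 1`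
(when `i_b ≥ 2`): `Σ_{π : π.init = π₀, every such c_b ⊆ (Λ_{i_b}(π))ᶜ} cw^A_{m+1}(π) ≤ (Π_{b : i_b = m+1} ζ K j i_b) · cw^A_m(π₀)`; hFB: the same for run B one level up through
`blockDownSet` (length `n ∈ [1, j]`, `Λ′_ℓ = blockDownSet Λ_{ℓ+1}`).  Conclusion: `RelWeightBound` at `crOfRecord₁₃K (keyReadingId₁₃ …) (badKeyReadingOfBigComponent₁₃ … (bigDialOfCard₁₃ K₀
((2ϱ+1)^4·k·L^{4lv}))) …`'s carriers with `W K := η₀ · 2^{−(K+1)}`. [bookkeeping] -/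
theorem relWeightBound_card_of_fibreFreshLetters_id_supNear_of_ppSelLive (hM : 0 < θ.τ9.M)
    (hsel : θ.ppSel = ppSelLiveOfRecord F N θ.ν θ.τ9 (EOfRecord₁₃ F N θ.toStage13Params) (wOfRecord₉ F N θ.toStage9Params))
    (hU : LocalBgMeasurable F N θ.ν) (hζsign : ∀ p g k s Pl Ql RS U V', 0 ≤ θ.ζ p g k s Pl Ql RS U V')
    {η : ℕ → ℕ → ℝ} {η₀ : ℝ} (hη0 : ∀ K j, 0 ≤ η K j) (hη1 : ∀ K j, η K j ≤ η₀) (hη₀ : η₀ ≤ 1)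
    (hD : ∀ K j, 2 * ((((2 * ϱ K j + 1) ^ 4 : ℕ) : ℝ) * 3 ^ 4 * ((2 * ϱ K j + 1) ^ 4 : ℕ)) ^ 2 * η K j ≤ 1)
    (hks : ∀ K j, Nat.clog 2 (Fintype.card (Site (F.P (K₀ + K)) (lv K j))) + K + j + 3 ≤ k K j) (hlv : ∀ K j, lv K j ≤ F.m + (K₀ + K))
    (hlvj : ∀ K, ∀ j ∈ Finset.Icc 1 (jcut K), lv K j ≤ j) (hmono : ∀ K i i', 1 ≤ i → i ≤ i' → i' ≤ jcut K → lv K i ≤ lv K i')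
    (hjcut : ∀ K, jcut K ≤ K₀ + K)
    {ζ : ℕ → ℕ → ℕ → ℝ} (hζ0 : ∀ K j i, 0 ≤ ζ K j i)
    (hζη : ∀ K, ∀ j ∈ Finset.Icc 1 (jcut K), ∑ i ∈ Finset.Icc 1 j, ((F.L ^ 4) ^ (lv K j - lv K i) : ℝ) * ζ K j i ≤ η K j)
    (hFA : ∀ (K : ℕ) (t : ℝ), |t| ≤ 1 → ∀ j ∈ Finset.Icc 1 (jcut K),
      ∀ p ∈ sepAnimalCoverFamily (SiteTouch (P := F.P (K₀ + K)) (j := lv K j)) (SupNear (P := F.P (K₀ + K)) (j := lv K j) (ϱ K j)) (k K j),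
      ∀ a ∈ p.2.pi (fun b => (Finset.Icc 1 j).sigma fun i => Finset.univ.filter (fun c : Site (F.P (K₀ + K)) (lv K i) =>
        (↑(iterBlock (lv K i) c) : Set (Site (F.P (K₀ + K)) 0)) ⊆ ↑(iterBlock (lv K j) b))),
      ∀ m, m + 1 ≤ j → ∀ π₀ : SeqOfRecord F θ.ν θ.τ9.M (histA₁₃ θ K₀ g₀ K) (K₀ + K) m,
      (∀ x ∈ p.2.attach, (a x.1 x.2).1 = m + 1 → 2 ≤ (a x.1 x.2).1 →
        (↑(iterBlock (lv K (a x.1 x.2).1) (a x.1 x.2).2) : Set (Site (F.P (K₀ + K)) 0)) ⊆ π₀.Λ ((a x.1 x.2).1 - 1)) →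
      ∑ π ∈ Finset.univ.filter (fun π : SeqOfRecord F θ.ν θ.τ9.M (histA₁₃ θ K₀ g₀ K) (K₀ + K) (m + 1) =>
          π.init = π₀ ∧ ∀ x ∈ p.2.attach, (a x.1 x.2).1 = m + 1 →
            (↑(iterBlock (lv K (a x.1 x.2).1) (a x.1 x.2).2) : Set (Site (F.P (K₀ + K)) 0)) ⊆ (π.Λ (a x.1 x.2).1)ᶜ),
        classWeightOfDatum₉ F N θ.toStage9Params (datumOfRecord₁₃CoPH F N θ hP) g₀ os (runA₁₃ F K₀ g₀ K) (histA₁₃ θ K₀ g₀ K) (m + 1) t π ≤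
      (∏ x ∈ p.2.attach.filter (fun x => (a x.1 x.2).1 = m + 1), ζ K j (a x.1 x.2).1) *
        classWeightOfDatum₉ F N θ.toStage9Params (datumOfRecord₁₃CoPH F N θ hP) g₀ os (runA₁₃ F K₀ g₀ K) (histA₁₃ θ K₀ g₀ K) m t π₀)
    (hFB : ∀ (K : ℕ) (t : ℝ), |t| ≤ 1 → ∀ j ∈ Finset.Icc 1 (jcut K),
      ∀ p ∈ sepAnimalCoverFamily (SiteTouch (P := F.P (K₀ + K)) (j := lv K j)) (SupNear (P := F.P (K₀ + K)) (j := lv K j) (ϱ K j)) (k K j),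
      ∀ a ∈ p.2.pi (fun b => (Finset.Icc 1 j).sigma fun i => Finset.univ.filter (fun c : Site (F.P (K₀ + K)) (lv K i) =>
        (↑(iterBlock (lv K i) c) : Set (Site (F.P (K₀ + K)) 0)) ⊆ ↑(iterBlock (lv K j) b))),
      ∀ n ∈ Finset.Icc 1 j, ∀ π₀ : SeqOfRecord F θ.ν θ.τ9.M (histB₁₃ θ K₀ g₀ K) (K₀ + K + 1) n,
      (∀ x ∈ p.2.attach, (a x.1 x.2).1 = n → 2 ≤ (a x.1 x.2).1 →
        (↑(iterBlock (lv K (a x.1 x.2).1) (a x.1 x.2).2) : Set (Site (F.P (K₀ + K)) 0)) ⊆ blockDownSet F (K₀ + K) (π₀.Λ ((a x.1 x.2).1 - 1 + 1))) →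
      ∑ π ∈ Finset.univ.filter (fun π : SeqOfRecord F θ.ν θ.τ9.M (histB₁₃ θ K₀ g₀ K) (K₀ + K + 1) (n + 1) =>
          π.init = π₀ ∧ ∀ x ∈ p.2.attach, (a x.1 x.2).1 = n →
            (↑(iterBlock (lv K (a x.1 x.2).1) (a x.1 x.2).2) : Set (Site (F.P (K₀ + K)) 0)) ⊆ (blockDownSet F (K₀ + K) (π.Λ ((a x.1 x.2).1 + 1)))ᶜ),
        classWeightOfDatum₉ F N θ.toStage9Params (datumOfRecord₁₃CoPH F N θ hP) g₀ os (runB₁₃ F K₀ g₀ K) (histB₁₃ θ K₀ g₀ K) (n + 1) t π ≤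
      (∏ x ∈ p.2.attach.filter (fun x => (a x.1 x.2).1 = n), ζ K j (a x.1 x.2).1) *
        classWeightOfDatum₉ F N θ.toStage9Params (datumOfRecord₁₃CoPH F N θ hP) g₀ os (runB₁₃ F K₀ g₀ K) (histB₁₃ θ K₀ g₀ K) n t π₀) :
    RelWeightBound 1 (classSetK₁₃ θ K₀ g₀ (keyReadingId₁₃ N K₀ F θ hP g₀ os)) (weightAK₁₃ θ hP K₀ g₀ os (keyReadingId₁₃ N K₀ F θ hP g₀ os))
      (weightBK₁₃ θ hP K₀ g₀ os (keyReadingId₁₃ N K₀ F θ hP g₀ os))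
      (badClassK₁₃ θ K₀ g₀ (keyReadingId₁₃ N K₀ F θ hP g₀ os)
        (badKeyReadingOfBigComponent₁₃ N K₀ jcut (bigDialOfCard₁₃ K₀ (fun K j => (2 * ϱ K j + 1) ^ 4 * k K j * (F.L ^ 4) ^ lv K j)) F θ hP g₀ os))
      (fun K => η₀ * (1 / 2) ^ (K + 1)) := by
  -- `0 ≤ w` of record from the sign law of `ζ`, hence non-negative class weights on both runs
  have hw0 : ∀ (p : B12.RunParams) (g : ℕ → ℝ) k s' U V', 0 ≤ wOfRecord₉ F N θ.toStage9Params p g k s' U V' := fun p g k s' U V' =>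
    wOfRecord_nonneg F N θ.ν θ.τ9.M p g k θ.A₁ hζsign s' U V'
  have hcw0 : ∀ (p : B12.RunParams) (g : ℕ → ℝ) (t : ℝ) m (π : SeqOfRecord F θ.ν θ.τ9.M g p.K m),
      0 ≤ classWeightOfDatum₉ F N θ.toStage9Params (datumOfRecord₁₃CoPH F N θ hP) g₀ os p g m t π := fun p g t m π =>
    integral_nonneg fun V => mul_nonneg (chiSeqOfRecord_nonneg F N θ.ν θ.τ9.M g p.K m π V)
      (dressedSlotsOfDatum₉_nonneg F N θ.toStage9Params (datumOfRecord₁₃CoPH F N θ hP) g₀ os p g (hw0 p g) t m π V)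
  refine relWeightBound_card_of_oneStepFreshLetters_id_supNear_of_ppSelLive θ hP K₀ g₀ os jcut ϱ k lv hM hsel hU hζsign hη0 hη1 hη₀ hD hks hlv
    hlvj hmono hjcut hζ0 hζη ?_ ?_
  · intro K t ht j hj p hp a ha i hi
    have hjK : j ≤ K₀ + K := (Finset.mem_Icc.1 hj).2.trans (hjcut K)
    exact oneStepFreshLetters_A_of_fibre θ hP K₀ g₀ os lv K t hjK p.2 (fun b hb => (Finset.mem_sigma.1 (Finset.mem_pi.1 ha b hb)).1)
      (hζ0 K j) (hcw0 (runA₁₃ F K₀ g₀ K) (histA₁₃ θ K₀ g₀ K) t)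
      (fun m hm π => classWeightOfDatum₉_telescoping_A_of_ppSelLive θ hP K₀ g₀ os hsel hU hζsign K t m hm π) (hFA K t ht j hj p hp a ha) i hi
  · intro K t ht j hj p hp a ha i hi
    have hjK : j ≤ K₀ + K := (Finset.mem_Icc.1 hj).2.trans (hjcut K)
    exact oneStepFreshLetters_B_of_fibre θ hP K₀ g₀ os lv hM K t hjK p.2 (fun b hb => (Finset.mem_sigma.1 (Finset.mem_pi.1 ha b hb)).1)
      (hζ0 K j) (hcw0 (runB₁₃ F K₀ g₀ K) (histB₁₃ θ K₀ g₀ K) t)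
      (fun m hm π => classWeightOfDatum₉_telescoping_B_of_ppSelLive θ hP K₀ g₀ os hsel hU hζsign K t m hm π) (hFB K t ht j hj p hp a ha) i hi

end Faces

end YMDAG.UVSplit

end
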